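import Mathlib
import HarnessLib
import Summits.ABC.ABC.Theses.LogCardinality

/-!
# The `ω(abc) = 2` member of `stub_fixedOmega` (line `regime_split` of crux `BakerRefinement`, stmt-ABC-1756)

BC5 special case of the few-primes piece `FewPrimesBaker` of the regime split of Baker's refinement: the
uniform two-primes bound holds with constant `κ = 1`,
`c < N·(log N)²/2` for every abc triple `a < b` with `ω(abc) = 2` (and `4 < log N`, the regime hypothesis of the
stub; in fact `c ≤ 2N` always). Elementary and Mihăilescu-free: `ω(abc) = 2` with `a < b` forces `a = 1`,
`b = p^x`, `c = q^y` (§2); `p^x + 1 = q^y` with `x, y ≥ 2` forces `8 + 1 = 9` (§1: parity, squares mod `4`,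
and lifting-the-exponent at `2` via Mathlib's `emultiplicity_pow_sub_pow_of_prime`); hence `c ≤ 2·pq ≤ 2N` (§3).
Intended Theorems target (prover-only): `Summits/ABC/ABC/Theorems/LogCardinalityFewPrimesOmegaTwo.lean`,
`--supports stmt-ABC-1756`. No `def`s; unconditional; standard axioms.
-/

-- `Summit.<Summit>.<Problem>`: for the single-conjunct summit `ABC` the duplicate `ABC.ABC` is mandated.
set_option linter.dupNamespace false

namespace Summit.ABC.ABC.Theorems

open Literature.NumberTheory.DiophantineGeometry
open scoped ArithmeticFunction.omega

/-! ## §1 Odd perfect powers next to powers of two -/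

/-- For odd `m > 1` and odd `n > 1`, `m^n + 1` is not a power of `2` (LTE at `2`: `v₂(m^n + 1) = v₂(m + 1)`).
[folklore] -/
theorem OmegaTwo.pow_add_one_ne_two_pow {m n y : ℕ} (hm : Odd m) (hm1 : 1 < m) (hn : Odd n) (hn1 : 1 < n) :
    m ^ n + 1 ≠ 2 ^ y := by
  intro h
  have h2 : Prime (2 : ℤ) := Int.prime_two
  have hmZ : Odd (m : ℤ) := by exact_mod_cast hm
  have hnZ : Odd (n : ℤ) := by exact_mod_cast hn
  have hxy : (2 : ℤ) ∣ (m : ℤ) - (-1) := by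
    rw [sub_neg_eq_add]; exact hmZ.add_one.two_dvd
  have hx : ¬ (2 : ℤ) ∣ (m : ℤ) := by
    rw [← even_iff_two_dvd]; exact Int.not_even_iff_odd.mpr hmZ
  have hn2 : ¬ (2 : ℤ) ∣ (n : ℤ) := by
    rw [← even_iff_two_dvd]; exact Int.not_even_iff_odd.mpr hnZ
  have key := emultiplicity_pow_sub_pow_of_prime h2 hxy hx hn2
  rw [Odd.neg_one_pow hn, sub_neg_eq_add, sub_neg_eq_add] at key
  have hcast : (m : ℤ) ^ n + 1 = (2 : ℤ) ^ y := by exact_mod_cast h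
  rw [hcast, emultiplicity_pow_self_of_prime h2] at key
  have hdvd : (2 : ℤ) ^ y ∣ (m : ℤ) + 1 := pow_dvd_of_le_emultiplicity (le_of_eq key)
  have hdvd' : 2 ^ y ∣ m + 1 := by exact_mod_cast hdvd
  have hle : 2 ^ y ≤ m + 1 := Nat.le_of_dvd (by omega) hdvd'
  have hlt : m < m ^ n := by
    calc m = m ^ 1 := (pow_one m).symm
      _ < m ^ n := Nat.pow_lt_pow_right hm1 hn1
  omega

/-- For odd `m > 1` and odd `n > 1`, `m^n − 1` is not a power of `2`, i.e. `m^n ≠ 2^x + 1` (LTE at `2`: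
`v₂(m^n − 1) = v₂(m − 1)`). [folklore] -/
theorem OmegaTwo.pow_ne_two_pow_add_one {m n x : ℕ} (hm : Odd m) (hm1 : 1 < m) (hn : Odd n) (hn1 : 1 < n) :
    m ^ n ≠ 2 ^ x + 1 := by
  intro h
  have h2 : Prime (2 : ℤ) := Int.prime_two
  have hmZ : Odd (m : ℤ) := by exact_mod_cast hm
  have hnZ : Odd (n : ℤ) := by exact_mod_cast hn
  have hxy : (2 : ℤ) ∣ (m : ℤ) - 1 := hmZ.sub_odd odd_one |>.two_dvd
  have hx : ¬ (2 : ℤ) ∣ (m : ℤ) := by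
    rw [← even_iff_two_dvd]; exact Int.not_even_iff_odd.mpr hmZ
  have hn2 : ¬ (2 : ℤ) ∣ (n : ℤ) := by
    rw [← even_iff_two_dvd]; exact Int.not_even_iff_odd.mpr hnZ
  have key := emultiplicity_pow_sub_pow_of_prime h2 hxy hx hn2
  rw [one_pow] at key
  have hcast : (m : ℤ) ^ n - 1 = (2 : ℤ) ^ x := by
    have : ((m ^ n : ℕ) : ℤ) = ((2 ^ x + 1 : ℕ) : ℤ) := by exact_mod_cast h
    push_cast at this; linarith
  rw [hcast, emultiplicity_pow_self_of_prime h2] at key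
  have hdvd : (2 : ℤ) ^ x ∣ (m : ℤ) - 1 := pow_dvd_of_le_emultiplicity (le_of_eq key)
  have hdvd' : 2 ^ x ∣ m - 1 := by
    have h1 : ((m - 1 : ℕ) : ℤ) = (m : ℤ) - 1 := by push_cast [Nat.cast_sub (by omega : 1 ≤ m)]; ring
    rw [← h1] at hdvd; exact_mod_cast hdvd
  have hle : 2 ^ x ≤ m - 1 := Nat.le_of_dvd (by omega) hdvd'
  have hlt : m < m ^ n := by
    calc m = m ^ 1 := (pow_one m).symm
      _ < m ^ n := Nat.pow_lt_pow_right hm1 hn1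
  omega

/-- For odd `m` and even `n ≥ 2`, `m^n + 1 ≡ 2 (mod 4)` is not a power of `2` beyond `2¹`. [folklore] -/
theorem OmegaTwo.pow_add_one_ne_two_pow_of_even {m n y : ℕ} (hm : Odd m) (hn : Even n) (hy : 2 ≤ y) :
    m ^ n + 1 ≠ 2 ^ y := by
  intro h
  obtain ⟨k, rfl⟩ := hn
  obtain ⟨j, hj⟩ := hm
  have hsq : m ^ (k + k) = (m ^ k) ^ 2 := by rw [sq, ← pow_add]
  have hodd : Odd (m ^ k) := by rw [hj]; exact (odd_two_mul_add_one j).pow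
  obtain ⟨r, hr⟩ := hodd
  have hmod : (m ^ (k + k) + 1) % 4 = 2 := by
    rw [hsq, hr]; ring_nf; omega
  have h4 : (2 ^ y) % 4 = 0 := by
    obtain ⟨z, rfl⟩ := Nat.exists_eq_add_of_le hy
    rw [pow_add]; norm_num [Nat.mul_mod_right]
  omega

/-- `2^x + 1 = q^y` with `q` odd, `y` even and `x, y ≥ 1`... forces `q^y = 9`, `2^x = 8`: the two factors
`q^{y/2} ∓ 1` are powers of `2` differing by `2`. [folklore] -/
theorem OmegaTwo.two_pow_add_one_eq_pow_even {q x y : ℕ} (hq : Odd q) (hy : Even y) (hy0 : y ≠ 0)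
    (h : 2 ^ x + 1 = q ^ y) : q ^ y = 9 ∧ x = 3 := by
  obtain ⟨k, rfl⟩ := hy
  have hk0 : k ≠ 0 := by omega
  set r := q ^ k with hr
  have hrodd : Odd r := hq.pow
  have hr3 : 3 ≤ r ∨ r = 1 := by
    obtain ⟨j, hj⟩ := hrodd; omega
  have hqy : q ^ (k + k) = r * r := by rw [pow_add]
  rw [hqy] at h ⊢
  have hr1 : r ≠ 1 := by
    rintro hr1; rw [hr1] at h; have : 2 ^ x = 0 := by omega
    exact absurd this (pow_ne_zero x two_ne_zero)
  have hr3' : 3 ≤ r := by omega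
  -- (r - 1) (r + 1) = 2^x
  have hfac : (r - 1) * (r + 1) = 2 ^ x := by
    have : r * r = 2 ^ x + 1 := h.symm
    have h1 : 1 ≤ r := by omega
    zify [h1] at this ⊢
    nlinarith
  have hd1 : r - 1 ∣ 2 ^ x := ⟨r + 1, hfac.symm⟩
  have hd2 : r + 1 ∣ 2 ^ x := ⟨r - 1, by rw [mul_comm]; exact hfac.symm⟩
  obtain ⟨i, hi, hri⟩ := (Nat.dvd_prime_pow Nat.prime_two).mp hd1
  obtain ⟨j, hj, hrj⟩ := (Nat.dvd_prime_pow Nat.prime_two).mp hd2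
  -- 2^j - 2^i = 2 with r odd ≥ 3: i = 1, j = 2
  have hi1 : i = 1 := by
    rcases Nat.lt_or_ge i 2 with hi2 | hi2
    · interval_cases i
      · exfalso; simp at hri; omega
      all_goals rfl
    · exfalso
      obtain ⟨i', rfl⟩ := Nat.exists_eq_add_of_le hi2
      have hj2 : 2 ≤ j := by
        by_contra hj2
        push Not at hj2
        interval_cases j <;> simp at hrj <;> omega
      obtain ⟨j', rfl⟩ := Nat.exists_eq_add_of_le hj2
      rw [pow_add] at hri hrj
      omega
  rw [hi1, pow_one] at hri
  have hr3'' : r = 3 := by omega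
  refine ⟨by rw [hr3''], ?_⟩
  rw [hr3''] at hfac
  have h8 : 2 ^ x = 2 ^ 3 := by omega
  exact Nat.pow_right_injective le_rfl h8

/-- **Prime-power Catalan, elementary case.** If `p^x + 1 = q^y` with `p, q` prime and `x, y ≥ 2`, then
`(p, x, q, y) = (2, 3, 3, 2)`. [folklore] -/
theorem OmegaTwo.classify {p q x y : ℕ} (hp : p.Prime) (hq : q.Prime) (hx : 2 ≤ x) (hy : 2 ≤ y)
    (h : p ^ x + 1 = q ^ y) : p = 2 ∧ x = 3 ∧ q = 3 ∧ y = 2 := by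
  rcases hp.eq_two_or_odd' with rfl | hpodd <;> rcases hq.eq_two_or_odd' with rfl | hqodd
  · -- 2^x + 1 = 2^y: parity
    exfalso
    have h1 : 2 ∣ 2 ^ x := dvd_pow_self 2 (by omega)
    have h2 : 2 ∣ 2 ^ y := dvd_pow_self 2 (by omega)
    omega
  · -- p = 2, q odd
    rcases Nat.even_or_odd y with hye | hyo
    · obtain ⟨h9, hx3⟩ := OmegaTwo.two_pow_add_one_eq_pow_even hqodd hye (by omega) h
      have hq3 : q = 3 := by
        have hq9 : q ∣ 9 := by rw [← h9]; exact dvd_pow_self q (by omega)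
        have : q ∣ 3 ^ 2 := by norm_num; exact hq9
        exact (Nat.prime_dvd_prime_iff_eq hq Nat.prime_three).mp (hq.dvd_of_dvd_pow this)
      subst hq3
      refine ⟨rfl, hx3, rfl, ?_⟩
      have : (3 : ℕ) ^ y = 3 ^ 2 := by rw [h9]; norm_num
      exact Nat.pow_right_injective (by norm_num) this
    · exfalso
      exact OmegaTwo.pow_ne_two_pow_add_one hqodd hq.one_lt hyo (by omega) h.symm
  · -- p odd, q = 2
    exfalso
    rcases Nat.even_or_odd x with hxe | hxo
    · exact OmegaTwo.pow_add_one_ne_two_pow_of_even hpodd hxe hy h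
    · exact OmegaTwo.pow_add_one_ne_two_pow hpodd hp.one_lt hxo (by omega) h
  · -- both odd: parity
    exfalso
    have h1 : Odd (p ^ x) := hpodd.pow
    have h2 : Odd (q ^ y) := hqodd.pow
    rw [← h] at h2
    exact (Nat.not_even_iff_odd.mpr h2) h1.add_one

/-! ## §2 abc triples `a < b` with `ω(abc) = 2` are `1 + p^x = q^y` -/

variable {a b c : ℕ}

/-- `ω(abc) = ω(a) + ω(b) + ω(c)` for an abc triple (pairwise coprimality). [folklore] -/
theorem OmegaTwo.cardDistinctFactors_abc (h : IsABCTriple a b c) : ω (a * b * c) = ω a + ω b + ω c := by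
  obtain ⟨ha, hb, habc, hcop⟩ := h
  have hac : Nat.Coprime a c := by rw [← habc]; exact Nat.coprime_self_add_right.mpr hcop
  have hbc : Nat.Coprime b c := by rw [← habc]; exact Nat.coprime_add_self_right.mpr hcop.symm
  rw [ArithmeticFunction.cardDistinctFactors_mul (Nat.Coprime.mul_left hac hbc),
    ArithmeticFunction.cardDistinctFactors_mul hcop]

/-- An abc triple `a < b` with `ω(abc) = 2` is `1 + p^x = q^y` with distinct primes `p, q` and `x, y ≥ 1`.
[folklore] -/
theorem OmegaTwo.shape (h : IsABCTriple a b c) (hab : a < b) (hω : ω (a * b * c) = 2) :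
    a = 1 ∧ ∃ p x q y : ℕ, p.Prime ∧ q.Prime ∧ 0 < x ∧ 0 < y ∧ b = p ^ x ∧ c = q ^ y ∧ p ≠ q := by
  have hsum := OmegaTwo.cardDistinctFactors_abc h
  obtain ⟨ha, hb, habc, hcop⟩ := h
  have hωb : 0 < ω b := ArithmeticFunction.cardDistinctFactors_pos.mpr (by omega)
  have hωc : 0 < ω c := ArithmeticFunction.cardDistinctFactors_pos.mpr (by omega)
  have hωa : ω a = 0 := by omega
  have hωb1 : ω b = 1 := by omega
  have hωc1 : ω c = 1 := by omega
  have ha1 : a = 1 := by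
    have := ArithmeticFunction.cardDistinctFactors_eq_zero.mp hωa; omega
  obtain ⟨p, x, hp, hx, rfl⟩ :=
    (isPrimePow_nat_iff _).mp (ArithmeticFunction.cardDistinctFactors_eq_one_iff.mp hωb1)
  obtain ⟨q, y, hq, hy, rfl⟩ :=
    (isPrimePow_nat_iff _).mp (ArithmeticFunction.cardDistinctFactors_eq_one_iff.mp hωc1)
  refine ⟨ha1, p, x, q, y, hp, hq, hx, hy, rfl, rfl, ?_⟩
  rintro rfl
  have hbc : Nat.Coprime (p ^ x) (p ^ y) := by
    rw [← habc]; exact Nat.coprime_add_self_right.mpr hcop.symm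
  have hg := Nat.dvd_gcd (dvd_pow_self p hx.ne') (dvd_pow_self p hy.ne')
  rw [hbc.gcd_eq_one] at hg
  exact hp.one_lt.ne' (Nat.dvd_one.mp hg)

/-! ## §3 Hence `c ≤ 2·rad(abc)` (unconditionally) -/

/-- For an abc triple `a < b` with `ω(abc) = 2`: `c ≤ 2·rad(abc)` (`c = q ≤ pq`, or `c = p + 1 ≤ pq`, or
`c = 9 ≤ 12`). [folklore] -/
theorem OmegaTwo.c_le_two_mul_rad (h : IsABCTriple a b c) (hab : a < b) (hω : ω (a * b * c) = 2) :
    c ≤ 2 * rad a b c := by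
  obtain ⟨ha1, p, x, q, y, hp, hq, hx, hy, hb, hc, hpq⟩ := OmegaTwo.shape h hab hω
  obtain ⟨ha, hb0, habc, hcop⟩ := h
  subst ha1 hb hc
  have h0 : 1 * p ^ x * q ^ y ≠ 0 := Nat.mul_ne_zero (Nat.mul_ne_zero one_ne_zero hb0.ne') (by omega)
  have hdvd_rad : ∀ r : ℕ, r.Prime → r ∣ 1 * p ^ x * q ^ y → r ∣ rad 1 (p ^ x) (q ^ y) := by
    intro r hr hrabc
    have hmem : r ∈ (rad 1 (p ^ x) (q ^ y)).primeFactors := by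
      rw [rad_def, Nat.primeFactors_radical, Nat.mem_primeFactors]
      exact ⟨hr, hrabc, h0⟩
    exact Nat.dvd_of_mem_primeFactors hmem
  have hprad : p ∣ rad 1 (p ^ x) (q ^ y) :=
    hdvd_rad p hp (((dvd_pow_self p hx.ne').mul_left 1).mul_right (q ^ y))
  have hqrad : q ∣ rad 1 (p ^ x) (q ^ y) :=
    hdvd_rad q hq ((dvd_pow_self q hy.ne').mul_left (1 * p ^ x))
  have hpqrad : p * q ∣ rad 1 (p ^ x) (q ^ y) :=
    Nat.Coprime.mul_dvd_of_dvd_of_dvd ((Nat.coprime_primes hp hq).mpr hpq) hprad hqrad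
  have hradpos : 0 < rad 1 (p ^ x) (q ^ y) := by rw [rad_def]; exact Nat.radical_pos _
  have hpq_le : p * q ≤ rad 1 (p ^ x) (q ^ y) := Nat.le_of_dvd hradpos hpqrad
  have hp2 := hp.two_le
  have hq2 := hq.two_le
  have heq : p ^ x + 1 = q ^ y := by omega
  rcases Nat.lt_or_ge y 2 with hy1 | hy2
  · -- `y = 1`: `c = q ≤ pq`
    have hy1' : y = 1 := by omega
    subst hy1'
    simp only [pow_one] at hpq_le ⊢
    nlinarith [hpq_le, hp2, hq2]
  rcases Nat.lt_or_ge x 2 with hx1 | hx2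
  · -- `x = 1`: `c = p + 1 ≤ 2p ≤ pq`
    have hx1' : x = 1 := by omega
    subst hx1'
    simp only [pow_one] at hpq_le heq ⊢
    calc q ^ y = p + 1 := heq.symm
      _ ≤ 2 * rad 1 p (q ^ y) := by nlinarith [hpq_le, hp2, hq2]
  · -- `x, y ≥ 2`: `8 + 1 = 9`, `pq = 6`
    obtain ⟨rfl, rfl, rfl, rfl⟩ := OmegaTwo.classify hp hq hx2 hy2 heq
    norm_num at hpq_le ⊢
    omega

/-! ## §4 The `ω = 2` member of `stub_fixedOmega` with `κ = 1` -/

/-- **The uniform two-primes Baker bound (κ = 1).** For every abc triple `a < b` with `ω(abc) = 2` in the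
few-primes regime `2² < log rad(abc)`: `c < 1·N·(log N)²/2!`. (From `c ≤ 2N` and `(log N)² > 16`.) [folklore] -/
theorem fewPrimes_fixedOmega_two (a b c : ℕ) (h : IsABCTriple a b c) (hab : a < b)
    (hω : ArithmeticFunction.cardDistinctFactors (a * b * c) = 2)
    (hreg : ((2 : ℕ) : ℝ) ^ 2 < Real.log (rad a b c : ℕ)) :
    (c : ℝ) < 1 * (rad a b c : ℝ) * Real.log (rad a b c : ℕ) ^ 2 / (Nat.factorial 2 : ℝ) := by
  have hc2 : (c : ℝ) ≤ 2 * (rad a b c : ℝ) := by exact_mod_cast OmegaTwo.c_le_two_mul_rad h hab hω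
  have hN0 : (0 : ℝ) < (rad a b c : ℝ) := by
    exact_mod_cast lt_of_lt_of_le (by norm_num) h.two_le_rad
  have hL : (4 : ℝ) < Real.log (rad a b c : ℕ) := by
    have : ((2 : ℕ) : ℝ) ^ 2 = 4 := by norm_num
    rwa [this] at hreg
  have hL0 : (0 : ℝ) < Real.log (rad a b c : ℕ) := by linarith
  rw [Nat.factorial_two]
  push_cast
  have key : 2 * (rad a b c : ℝ) < 1 * (rad a b c : ℝ) * Real.log (rad a b c : ℕ) ^ 2 / 2 := by
    rw [lt_div_iff₀ two_pos]
    have h16 : (16 : ℝ) < Real.log (rad a b c : ℕ) ^ 2 := by nlinarith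
    nlinarith
  linarith

/-- The `t = 2` instance of the registered stub `stub_fixedOmega` of `Cruxes/BakerRefinement/Lines/regime_split.lean`
(statement verbatim with `t := 2`), witnessed by `κ = 1`. [folklore] -/
theorem stub_fixedOmega_two :
    ∃ κ : ℝ, ∀ a b c : ℕ, IsABCTriple a b c → a < b →
      ArithmeticFunction.cardDistinctFactors (a * b * c) = 2 →
        ((2 : ℕ) : ℝ) ^ 2 < Real.log (rad a b c : ℕ) →
          (c : ℝ) < κ * (rad a b c : ℝ) * Real.log (rad a b c : ℕ) ^ 2 / (Nat.factorial 2 : ℝ) :=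
  ⟨1, fewPrimes_fixedOmega_two⟩

/-- Vacuity of the `t ≤ 1` members: an abc triple with `a < b` has `ω(abc) ≥ 2` (`b, c ≥ 2` coprime). [folklore] -/
theorem OmegaTwo.two_le_cardDistinctFactors (h : IsABCTriple a b c) (hab : a < b) : 2 ≤ ω (a * b * c) := by
  have hsum := OmegaTwo.cardDistinctFactors_abc h
  obtain ⟨ha, hb, habc, hcop⟩ := h
  have hωb : 0 < ω b := ArithmeticFunction.cardDistinctFactors_pos.mpr (by omega)
  have hωc : 0 < ω c := ArithmeticFunction.cardDistinctFactors_pos.mpr (by omega)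
  omega

end Summit.ABC.ABC.Theorems
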